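import Summits.QuantumAdvantage.QuantumAdvantage.Theorems.CubicForrelationNearExactIsExactTwelveWeightGapNone

/-!
# Crux `CubicForrelation.NearExactIsExact` (stmt-QuantumAdvantage-14043) — n = 12: a TYPE-O side has `Φ ≤ 940/1024`

Certificate seat `b2b-cforr-cert` (gen 15).  HONEST FRAMING: a kernel-checked lemma (standard axioms) about cubic Boolean pairs on 12 bits —
the type-O branch two rungs below `to15_typeO_le_942`, using the weight gap `(768, 816]` (`to15_weight_gap_none`).  NOT summit progress.

`to15_typeO_le_940`: a type-O side (`W_g = 16u`, some `u` odd) has `Φ ≤ 940/1024`: otherwise `2¹⁷(1 − Φ) < 10752` bounds the base energy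
`4096 + 8#E`, so `#E < 832`; `#E ≥ 768` (`to15_typeO_E_ge_768`), `#E ≠ 768` (`to15_typeO_E768_le`), `#E ∉ (768, 816]` (`to15_weight_gap_none`)
and `16 ∣ #E` (`to15_weight_gap16`) are incompatible.

References: Kasami–Tokura (1970); MacWilliams–Sloane (1977) Ch. 15; Carlet (2021) §5; O'Donnell (2014) §3.3.  Axioms: standard.
-/

set_option linter.dupNamespace false -- D-0017: single-problem summit ⇒ `QuantumAdvantage.QuantumAdvantage` by design

noncomputable section

namespace Summit.QuantumAdvantage.QuantumAdvantage.Theorems.CubicForrelation.NearExactIsExact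

open Finset
open Literature.Computability.QuantumComplexity
open Literature.Computability.QuantumComplexity.BuzetChailloux (bxor zeroVec bxor_bxor_cancel_left bxor_zeroVec zeroVec_bxor bxor_comm
  bxor_self twist_zeroVec_right twist_bxor_right)
open Literature.Computability.QuantumComplexity.DerivativeWalsh (W twist_bxor_left)
open Summit.QuantumAdvantage.QuantumAdvantage.Theorems.NearExactIsExact.Negative (TypeOTwelve.typeO_of_exists_odd)

/-! ### The type-O ceiling `940/1024` -/

/-- **A type-O side has `Φ ≤ 940/1024` (12 bits).**  Cubic `f, g : 𝔽₂¹² → 𝔽₂` with `W_g = 16u` and some `u(x)` odd: `Φ(f,g) ≤ 940/1024`.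
(Above it the base energy `4096 + 8#E ≤ 2¹⁷(1 − Φ) < 10752` forces `#E < 832`; `#E ≥ 768`, `#E ≠ 768`, no cubic weight in `(768, 816]`
(`to15_weight_gap_none`) and `16 ∣ #E` leave nothing.)  Finite-slice statement; NOT summit progress. [this work] -/
theorem to15_typeO_le_940 (f g : (Fin (6 + 6) → Bool) → Bool) (hf : IsDegLeFun 3 f) (hg : IsDegLeFun 3 g)
    (u : (Fin (6 + 6) → Bool) → ℤ) (hu : ∀ x, W (fun y => signOf (g y)) x = (2 : ℝ) ^ 4 * (u x : ℝ))
    (hodd : ∃ x, Odd (u x)) : forrelation f g ≤ 940 / 1024 := by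
  classical
  by_contra hΦ
  push Not at hΦ
  have hall : ∀ x, Odd (u x) := TypeOTwelve.typeO_of_exists_odd g u hg hu hodd
  have hu' : ∀ x, W (fun y => signOf (g y)) x = (2 : ℝ) ^ (2 * 2) * (u x : ℝ) := fun x => (hu x).trans (by norm_num)
  have hd1 : IsDegLeFun 1 (fun x => decide (Odd (u x / 2))) := z2_digitOne 2 g u hg hu' hall
  have hd2 : IsDegLeFun 3 (fun x => decide (Odd (u x / 2 / 2))) := z2_digitTwo 2 g u hg hu' hall
  set E := univ.filter (fun x : Fin (6 + 6) → Bool => (Odd (u x / 2) ↔ Odd (u x / 2 / 2))) with hEdef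
  have hdegE : IsDegLeFun (2 + 1) (fun x => (decide (Odd (u x / 2)) ^^ decide (Odd (u x / 2 / 2))) ^^ true) :=
    tb_isDegLeFun_xor_const (bb_isDegLeFun_bxor (hd1.mono (by norm_num)) hd2) true
  have hsetE : (univ.filter fun x : Fin (6 + 6) → Bool =>
      ((decide (Odd (u x / 2)) ^^ decide (Odd (u x / 2 / 2))) ^^ true) = true) = E := by
    rw [hEdef]
    apply filter_congr
    intro x _
    by_cases h1 : Odd (u x / 2) <;> by_cases h2 : Odd (u x / 2 / 2) <;> simp [h1, h2]
  have hsumE : (∑ x, (if (Odd (u x / 2) ↔ Odd (u x / 2 / 2)) then 1 else 0 : ℤ)) = #E := by rw [sum_boole]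
  -- `#E ≥ 768`, `#E ≠ 768`
  have hE768 : 768 ≤ #E := to15_typeO_E_ge_768 f g hf hg u hu hodd (by linarith)
  have hEne : #E ≠ 768 := by
    intro h
    have := to15_typeO_E768_le f g hf hg u hu hodd h
    linarith
  -- budget: `4096 + 8#E ≤ Σ τ² = 2¹⁷(1 − Φ) < 10752`
  have hbud := tw12_budget f g u hu
  have hT : (∑ x, (u x - 4 * sZ (f x)) ^ 2 : ℤ) ≤ 10751 := by
    have h' : ((∑ x, (u x - 4 * sZ (f x)) ^ 2 : ℤ) : ℝ) < 10752 := by rw [hbud]; linarith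
    have h'' : (∑ x, (u x - 4 * sZ (f x)) ^ 2 : ℤ) < 10752 := by exact_mod_cast h'
    omega
  choose v hv using fun x => to12_pt_mod8 (u x) (sZ (f x)) (hall x) (tp_sZ_cases (f x))
  set τ₀ : (Fin (6 + 6) → Bool) → ℤ := fun x =>
    sZ (decide (Odd (u x / 2))) * (1 - 4 * (if (Odd (u x / 2) ↔ Odd (u x / 2 / 2)) then 1 else 0)) with hτ₀def
  have hvx : ∀ x, u x - 4 * sZ (f x) = τ₀ x + 8 * v x := fun x => hv x
  have hτ₀val : ∀ x, τ₀ x = 1 ∨ τ₀ x = -1 ∨ τ₀ x = 3 ∨ τ₀ x = -3 := by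
    intro x
    simp only [τ₀]
    rcases tp_sZ_cases (decide (Odd (u x / 2))) with h | h <;> rw [h] <;> split_ifs <;> norm_num
  have hτ₀sq : ∀ x, τ₀ x ^ 2 = 1 + 8 * (if (Odd (u x / 2) ↔ Odd (u x / 2 / 2)) then 1 else 0 : ℤ) := by
    intro x
    simp only [τ₀]
    rcases tp_sZ_cases (decide (Odd (u x / 2))) with h | h <;> rw [h] <;> split_ifs <;> norm_num
  have hsumτ₀ : ∑ x, τ₀ x ^ 2 = 4096 + 8 * #E := by
    rw [sum_congr rfl fun x _ => hτ₀sq x, sum_add_distrib, ← mul_sum, hsumE, sum_const, card_univ, Fintype.card_fun,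
      Fintype.card_bool, Fintype.card_fin]
    norm_num
  set X : (Fin (6 + 6) → Bool) → ℤ := fun x => (τ₀ x + 8 * v x) ^ 2 - τ₀ x ^ 2 with hXdef
  have hXnn : ∀ x, 0 ≤ X x := fun x => to12_excess_nonneg _ _ (hτ₀val x)
  have hTdec : (∑ x, (u x - 4 * sZ (f x)) ^ 2 : ℤ) = ∑ x, τ₀ x ^ 2 + ∑ x, X x := by
    rw [← sum_add_distrib]
    exact sum_congr rfl fun x _ => by rw [hvx x]; simp only [X]; ring
  have hXsum_nn : 0 ≤ ∑ x, X x := sum_nonneg fun x _ => hXnn x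
  have hE832 : #E < 832 := by
    rw [hTdec, hsumτ₀] at hT
    have : (8 : ℤ) * #E ≤ 6655 := by linarith
    have : 8 * #E ≤ 6655 := by exact_mod_cast this
    omega
  -- `16 ∣ #E` excludes `(816, 832)`; `to15_weight_gap_none` excludes `(768, 816]`
  have h16 : 16 ∣ #E := by
    have h := to15_weight_gap16 _ hdegE (by rw [hsetE]; omega) (by rw [hsetE]; omega)
    rwa [hsetE] at h
  have hE816 : #E ≤ 816 := by omega
  exact to15_weight_gap_none _ hdegE (by rw [hsetE]; omega) (by rw [hsetE]; exact hE816)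

end Summit.QuantumAdvantage.QuantumAdvantage.Theorems.CubicForrelation.NearExactIsExact

end
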